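import Literature.Probability.RandomPlanarGeometry.SLEImageLocalisationPaths
import HarnessLib

/-!
# The localised image driving process of SLE_κ under a `*`-hull: the localising time is a stopping time

Sequel of `SLEImageLocalisationPaths` ([LSW] 2003 §5; Lawler–Schramm–Werner (2001) Thm. 2.2): the
localising time `imgLocTimeK = Tₙ ∧ capTimeK` of `SLEImageLocalisation` is a stopping time of the
Brownian filtration (`Tₙ` is, `isStoppingTime_locTimeK`; the cap time is the hitting time of a closed
set by the continuous adapted process `|W|`), and the bracket clock `imgClockK` (time integral of the
rate `(D̂ⁿ⁺¹)²` truncated at the localising time) is adapted. Theorems only.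

## References

* [LSW] 2003, §5. [LawlerSchrammWerner2003Restriction]
* D. Revuz, M. Yor (1999), Ch. I Prop. (4.6). [RevuzYor1999]
-/

noncomputable section

open Set Filter Metric Function MeasureTheory
open _root_.Complex _root_.Topology
open Literature.Probability.Process (brownian preWienerMeasure)
open Literature.Analysis.FunctionSpaces (timeIntegral trunc)
open scoped NNReal

namespace Literature.Probability.RandomPlanarGeometry

open Loewner PathOps

variable {κ : ℝ≥0} {A : Set ℂ} {hA : IsStarHull A} {hne : A.Nonempty} {n : ℕ}

/-! ### The localising time is a stopping time; the clock is adapted -/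

section Adapted

/-- `|W|` along the Brownian path is adapted. [folklore] -/
theorem adapted_abs_drvK_brownianCPath (κ : ℝ≥0) :
    Adapted brownianFiltration fun t (ω : ℝ≥0 → ℝ) ↦ |drvK κ (brownianCPath ω) t| := fun _ ↦
  continuous_abs.measurable.comp (measurable_drvK_brownianCPath_of_le le_rfl)

/-- **The cap time is a stopping time** (hitting time of a closed set by a continuous adapted process).
[folklore] -/
theorem isStoppingTime_capTimeK (κ : ℝ≥0) (n : ℕ) : IsStoppingTime brownianFiltration (capTimeK κ n) :=
  Process.isStoppingTime_hittingAfter_of_continuous (adapted_abs_drvK_brownianCPath κ)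
    (fun ω ↦ (continuous_drvK κ (brownianCPath ω)).abs) isClosed_Ici

/-- **The localising time `imgLocTimeK n` is a stopping time** of the Brownian filtration. [folklore] -/
theorem isStoppingTime_imgLocTimeK (n : ℕ) : IsStoppingTime brownianFiltration (imgLocTimeK κ hA hne n) :=
  (isStoppingTime_locTimeK n).min (isStoppingTime_capTimeK κ n)

/-- The rate `(D̂ⁿ⁺¹)²` is adapted with continuous paths, hence strongly progressive. [folklore] -/
theorem isStronglyProgressive_imgRateK (n : ℕ) : IsStronglyProgressive brownianFiltration (imgRateK κ hA hne n) := by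
  have had : Adapted brownianFiltration (imgRateK κ hA hne n) := fun t ↦
    (adapted_DhatpK (κ := κ) (hA := hA) (hne := hne) (n + 1) t).pow_const 2
  exact had.stronglyAdapted.isStronglyProgressive_of_continuous fun ω ↦
    (continuous_RpK_DhatpK (κ := κ) (hA := hA) (hne := hne) (n + 1) ω).2.pow 2

/-- **The bracket clock is adapted** (the truncated rate is progressive; Fubini). [folklore] -/
theorem adapted_imgClockK (n : ℕ) : Adapted brownianFiltration (imgClockK κ hA hne n) :=
  Literature.Analysis.FunctionSpaces.adapted_timeIntegral
    (Literature.Analysis.FunctionSpaces.isStronglyProgressive_trunc (isStronglyProgressive_imgRateK n)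
      fun t ↦ (isStoppingTime_imgLocTimeK n).measurableSet_lt t)

/-- The events `{u < imgLocTimeK}` and `{imgLocTimeK < v}` are measurable. [folklore] -/
theorem measurableSet_lt_imgLocTimeK (n : ℕ) (u v : ℝ≥0) :
    MeasurableSet[brownianFiltration u] {ω | (u : WithTop ℝ≥0) < imgLocTimeK κ hA hne n ω} ∧
      MeasurableSet {ω | (u : WithTop ℝ≥0) < imgLocTimeK κ hA hne n ω} ∧
      MeasurableSet {ω | imgLocTimeK κ hA hne n ω < (v : WithTop ℝ≥0)} :=
  ⟨(isStoppingTime_imgLocTimeK n).measurableSet_gt u,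
    brownianFiltration.le u _ ((isStoppingTime_imgLocTimeK n).measurableSet_gt u),
    brownianFiltration.le v _ ((isStoppingTime_imgLocTimeK n).measurableSet_lt v)⟩

end Adapted

end Literature.Probability.RandomPlanarGeometry

end
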